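import Summits.RiemannHypothesis.RiemannHypothesis.Theorems.IntegerScrewCensusDualSlack

/-!
# Route `IntegerScrew` — kernel checker for the census DUAL certificates (8): size bounds

Entries below `maxAbsZ`, row sums, and the cell digits `dRE`, `dIM` below the slot bound `2^{SW−1}` under the caps of
`dualLight` (`n ≤ 112`, `|Z_ab| ≤ 2^62`, weights `< 2^236`, `|x|,|y| ≤ 2^53`).  RH-free; nothing here bears on the truth of RH.
-/

set_option linter.dupNamespace false
set_option autoImplicit false

namespace Summit.RiemannHypothesis.RiemannHypothesis.Theorems.IntegerScrew.Manifest.Fast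

open Finset
open Literature.Analysis.ValidatedNumerics.KroneckerDot

/-! ### Size bounds: entries, row sums, digits -/

/-- **Entries are below `maxAbsZ`** (out-of-range entries are `0`). -/
theorem abs_getD_le_maxAbsZ (Z : List (List ℤ)) (a b : ℕ) : ((Z.getD a []).getD b 0).natAbs ≤ maxAbsZ Z := by
  have le_foldr_max : ∀ {l : List ℕ} {x : ℕ}, x ∈ l → x ≤ l.foldr max 0 := by
    intro l
    induction l with
    | nil => intro x hx; simp at hx
    | cons y ys ih =>
      intro x hx
      simp only [List.foldr_cons]
      rcases List.mem_cons.1 hx with rfl | h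
      · exact le_max_left _ _
      · exact le_trans (ih h) (le_max_right _ _)
  by_cases ha : a < Z.length
  · by_cases hb : b < (Z.getD a []).length
    · unfold maxAbsZ
      refine le_trans ?_ (le_foldr_max (List.mem_map.2 ⟨Z.getD a [], ?_, rfl⟩))
      · exact le_foldr_max (List.mem_map.2 ⟨_, by rw [List.getD_eq_getElem _ _ hb]; exact List.getElem_mem hb, rfl⟩)
      · rw [List.getD_eq_getElem _ _ ha]; exact List.getElem_mem ha
    · rw [List.getD_eq_default _ _ (not_lt.1 hb)]; simp
  · rw [List.getD_eq_default _ _ (not_lt.1 ha)]; simp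

/-- `|Σ l| ≤ |l|·B` if every `|z| ≤ B`. -/
theorem abs_sumZ_le {B : ℕ} : ∀ (l : List ℤ), (∀ z ∈ l, z.natAbs ≤ B) → |(sumZ l : ℝ)| ≤ l.length * B
  | [], _ => by simp [sumZ]
  | z :: zs, h => by
    simp only [sumZ, List.length_cons]
    push_cast
    have hz : |(z : ℝ)| ≤ B := by
      rw [← Int.cast_abs, ← Nat.cast_natAbs]; exact_mod_cast h z (by simp)
    have ih := abs_sumZ_le zs fun w hw => h w (by simp [hw])
    calc |(z : ℝ) + (sumZ zs : ℝ)| ≤ |(z : ℝ)| + |(sumZ zs : ℝ)| := abs_add_le _ _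
      _ ≤ B + zs.length * B := add_le_add hz ih
      _ = (zs.length + 1 : ℝ) * B := by ring

/-- **Row sums**: `|rowsum_a| ≤ n · maxAbsZ` for a square `Z`. -/
theorem abs_sumZ_row_le (Z : List (List ℤ)) (hsq : ∀ row ∈ Z, row.length = Z.length) (a : ℕ) :
    |(sumZ (Z.getD a []) : ℝ)| ≤ Z.length * maxAbsZ Z := by
  by_cases ha : a < Z.length
  · have hrow : (Z.getD a []).length = Z.length := by
      rw [List.getD_eq_getElem _ _ ha]; exact hsq _ (List.getElem_mem ha)
    have h := abs_sumZ_le (B := maxAbsZ Z) (Z.getD a []) fun z hz => by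
      obtain ⟨b, hb, rfl⟩ := List.getElem_of_mem hz
      have := abs_getD_le_maxAbsZ Z a b
      rwa [List.getD_eq_getElem _ _ hb] at this
    rwa [hrow] at h
  · rw [List.getD_eq_default _ _ (not_lt.1 ha)]
    simp [sumZ]
    positivity

set_option exponentiation.threshold 500 in
/-- **The digits are below the slot bound**: with `n ≤ 112`, `|Z_ab| ≤ 2^62`, weights `< 2^236` and `|x|,|y| ≤ 2^53`,
`|dRE_k|, |dIM_k| < 2^{SW−1}`. -/
theorem digits_lt {D E : ℕ} (Z : List (List ℤ)) (φs : List ℕ) (xys : List (ℤ × ℤ)) {φmax : ℕ}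
    (hn : Z.length ≤ 112) (hsq : ∀ row ∈ Z, row.length = Z.length) (hZ : maxAbsZ Z ≤ 2 ^ 62)
    (hw : ∀ φ, φ ≤ φmax → ∀ k, k < D + 1 → wAt (kConsts D E) φ k < 2 ^ 236)
    (hφ : ∀ a, a < Z.length → φs.getD a 0 ≤ φmax)
    (hxy : ∀ a, |(xys.getD a (0, 0)).1| ≤ 2 ^ 53 ∧ |(xys.getD a (0, 0)).2| ≤ 2 ^ 53) {k : ℕ} (hk : k < D + 1) :
    |dRE (kConsts D E) Z φs xys k| < 2 ^ (SW - 1) ∧ |dIM (kConsts D E) Z φs xys k| < 2 ^ (SW - 1) := by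
  have hZr : ∀ a b, |(((Z.getD a []).getD b 0 : ℤ) : ℝ)| ≤ 2 ^ 62 := fun a b => by
    rw [← Int.cast_abs, ← Nat.cast_natAbs]; exact_mod_cast (abs_getD_le_maxAbsZ Z a b).trans hZ
  have hS : ∀ a, |(sumZ (Z.getD a []) : ℝ)| ≤ 112 * 2 ^ 62 := fun a => by
    refine (abs_sumZ_row_le Z hsq a).trans ?_
    have h1 : (Z.length : ℝ) ≤ 112 := by exact_mod_cast hn
    have h2 : (maxAbsZ Z : ℝ) ≤ 2 ^ 62 := by exact_mod_cast hZ
    exact mul_le_mul h1 h2 (by positivity) (by norm_num)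
  have hx : ∀ a, |((xys.getD a (0, 0)).1 : ℝ)| ≤ 2 ^ 53 ∧ |((xys.getD a (0, 0)).2 : ℝ)| ≤ 2 ^ 53 := fun a => by
    obtain ⟨h1, h2⟩ := hxy a
    exact ⟨by exact_mod_cast h1, by exact_mod_cast h2⟩
  have hwr : ∀ a, a < Z.length → ∀ b, ((wAt (kConsts D E) (φs.getD a 0 - φs.getD b 0) k : ℕ) : ℝ) ≤ 2 ^ 236 ∧
      ((wAt (kConsts D E) (φs.getD a 0) k : ℕ) : ℝ) ≤ 2 ^ 236 := fun a ha b =>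
    ⟨by exact_mod_cast (hw _ (le_trans (Nat.sub_le _ _) (hφ a ha)) k hk).le, by exact_mod_cast (hw _ (hφ a ha) k hk).le⟩
  have hSW : ((2 : ℤ) ^ (SW - 1) : ℤ) = (((2 : ℕ) ^ 423 : ℕ) : ℤ) := by norm_num [SW]
  have hScl : ((SCL : ℕ) : ℝ) = 2 ^ 52 := by norm_num [SCL]
  -- termwise bounds
  have hP : ∀ a, a < Z.length → ∀ b (u : ℝ), |u| ≤ 2 ^ 107 →
      |((pairW (kConsts D E) Z φs a b k : ℤ) : ℝ) * u| ≤ 2 ^ 406 := by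
    intro a ha b u hu
    unfold pairW; push_cast
    simp only [abs_mul, Nat.abs_cast, abs_two]
    calc 2 * |(((Z.getD a []).getD b 0 : ℤ) : ℝ)| * ((wAt (kConsts D E) (φs.getD a 0 - φs.getD b 0) k : ℕ) : ℝ) * |u| ≤
        2 * 2 ^ 62 * 2 ^ 236 * 2 ^ 107 := by gcongr; exacts [hZr a b, (hwr a ha b).1]
      _ = 2 ^ 406 := by norm_num
  have hN : ∀ a, a < Z.length → ∀ (u : ℝ), |u| ≤ 2 ^ 53 → |((nodeW (kConsts D E) Z φs a k : ℤ) : ℝ) * u| ≤ 2 ^ 411 := by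
    intro a ha u hu
    unfold nodeW; push_cast
    simp only [abs_mul, abs_neg, Nat.abs_cast, abs_two, hScl, abs_pow]
    calc 2 * |(sumZ (Z.getD a []) : ℝ)| * 2 ^ 52 * ((wAt (kConsts D E) (φs.getD a 0) k : ℕ) : ℝ) * |u| ≤
        2 * (112 * 2 ^ 62) * 2 ^ 52 * 2 ^ 236 * 2 ^ 53 := by gcongr; exacts [hS a, (hwr a ha 0).2]
      _ ≤ 2 ^ 411 := by norm_num
  have hu1 : ∀ a b, |((xys.getD a (0, 0)).1 : ℝ) * (xys.getD b (0, 0)).1 + ((xys.getD a (0, 0)).2 : ℝ) * (xys.getD b (0, 0)).2| ≤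
      2 ^ 107 := fun a b => by
    obtain ⟨h1, h2⟩ := hx a; obtain ⟨h3, h4⟩ := hx b
    calc _ ≤ |((xys.getD a (0, 0)).1 : ℝ) * (xys.getD b (0, 0)).1| + |((xys.getD a (0, 0)).2 : ℝ) * (xys.getD b (0, 0)).2| :=
          abs_add_le _ _
      _ ≤ 2 ^ 53 * 2 ^ 53 + 2 ^ 53 * 2 ^ 53 := by rw [abs_mul, abs_mul]; gcongr
      _ = 2 ^ 107 := by norm_num
  have hu2 : ∀ a b, |((xys.getD a (0, 0)).2 : ℝ) * (xys.getD b (0, 0)).1 - ((xys.getD a (0, 0)).1 : ℝ) * (xys.getD b (0, 0)).2| ≤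
      2 ^ 107 := fun a b => by
    obtain ⟨h1, h2⟩ := hx a; obtain ⟨h3, h4⟩ := hx b
    calc _ ≤ |((xys.getD a (0, 0)).2 : ℝ) * (xys.getD b (0, 0)).1| + |((xys.getD a (0, 0)).1 : ℝ) * (xys.getD b (0, 0)).2| :=
          abs_sub _ _
      _ ≤ 2 ^ 53 * 2 ^ 53 + 2 ^ 53 * 2 ^ 53 := by rw [abs_mul, abs_mul]; gcongr
      _ = 2 ^ 107 := by norm_num
  have hnR : (Z.length : ℝ) ≤ 112 := by exact_mod_cast hn
  -- the double sums
  have hsum : ∀ (P : ℕ → ℕ → ℝ) (N : ℕ → ℝ), (∀ a, a < Z.length → ∀ b, |P a b| ≤ 2 ^ 406) → (∀ a, a < Z.length → |N a| ≤ 2 ^ 411) →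
      |∑ a ∈ range Z.length, ∑ b ∈ range a, P a b + ∑ a ∈ range Z.length, N a| < 2 ^ 423 := by
    intro P N hPb hNb
    have h1 : |∑ a ∈ range Z.length, ∑ b ∈ range a, P a b| ≤ 112 * (112 * 2 ^ 406) := by
      refine (Finset.abs_sum_le_sum_abs _ _).trans ?_
      have hin : ∀ a ∈ range Z.length, |∑ b ∈ range a, P a b| ≤ 112 * 2 ^ 406 := by
        intro a ha
        have ha' := Finset.mem_range.1 ha
        refine (Finset.abs_sum_le_sum_abs _ _).trans ((Finset.sum_le_sum fun b _ => hPb a ha' b).trans ?_)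
        rw [Finset.sum_const, Finset.card_range, nsmul_eq_mul]
        have : (a : ℝ) ≤ 112 := by exact_mod_cast (ha'.le.trans hn)
        gcongr
      refine (Finset.sum_le_sum hin).trans ?_
      rw [Finset.sum_const, Finset.card_range, nsmul_eq_mul]; gcongr
    have h2 : |∑ a ∈ range Z.length, N a| ≤ 112 * 2 ^ 411 := by
      refine (Finset.abs_sum_le_sum_abs _ _).trans ((Finset.sum_le_sum fun a ha => hNb a (Finset.mem_range.1 ha)).trans ?_)
      rw [Finset.sum_const, Finset.card_range, nsmul_eq_mul]; gcongr
    calc _ ≤ |∑ a ∈ range Z.length, ∑ b ∈ range a, P a b| + |∑ a ∈ range Z.length, N a| := abs_add_le _ _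
      _ ≤ 112 * (112 * 2 ^ 406) + 112 * 2 ^ 411 := add_le_add h1 h2
      _ < 2 ^ 423 := by norm_num
  constructor
  · have : |((dRE (kConsts D E) Z φs xys k : ℤ) : ℝ)| < 2 ^ 423 := by
      unfold dRE; push_cast
      exact hsum _ _ (fun a ha b => hP a ha b _ (hu1 a b)) (fun a ha => hN a ha _ (hx a).1)
    have h' : |dRE (kConsts D E) Z φs xys k| < ((2 : ℕ) ^ 423 : ℕ) := by exact_mod_cast this
    rw [hSW]; exact_mod_cast h'
  · have : |((dIM (kConsts D E) Z φs xys k : ℤ) : ℝ)| < 2 ^ 423 := by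
      unfold dIM; push_cast
      exact hsum _ _ (fun a ha b => hP a ha b _ (hu2 a b)) (fun a ha => hN a ha _ (hx a).2)
    have h' : |dIM (kConsts D E) Z φs xys k| < ((2 : ℕ) ^ 423 : ℕ) := by exact_mod_cast this
    rw [hSW]; exact_mod_cast h'

end Summit.RiemannHypothesis.RiemannHypothesis.Theorems.IntegerScrew.Manifest.Fast
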